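import Summits.Ventures.Crystal3D.Theorems.StickyWulffConstantGenericWallFloorStackWalkRay
import Summits.Ventures.Crystal3D.Theorems.StickyWulffConstantGenericWallFloorStackWalkRayWords
import Summits.Ventures.Crystal3D.Theorems.StickyWulffConstantGenericWallFloorInPlaneTwinOnly
import HarnessLib

/-!
# The cross analysis at every level: on a `Σ3ᵏ` chain pair whose forced rays leave the chain at levels `≤ l + 1` and
# `≤ c + 1` with `l + c + 1 ≤ k`, a co-axial pair of walker tops is the in-plane twin pair `(T_l, T_{l+1})`
# (crux `GenericWallFloor`, stmt-Ventures-19480, line `WallLedgerG`)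

HONEST FRAMING. Venture `Summits/Ventures/Crystal3D` (cell `crystal3d-full`), helper `--supports` the crux
`GenericWallFloor` of `route-Ventures-StickyWulffConstant`, REGISTERED line `WallLedgerG`, open stub
`stub_twoSlabAdhesion`.  Rung credit only; F-C1 not moved; NOT the crux.

**`inPlaneTwinData_of_coaxial_ray`.**  `A₂·Λ₀ = (wordFrame A₁ κ)·Λ₀` for a reduced model menu word `κ` of length `k`
(twin tree `A₁ = T₀ – T₁ – ⋯ – T_k ∼ A₂`, plane `i` between `T_{i−1}` and `T_i` has model letter `κ[k − i]`).  Hypotheses,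
all finitely checkable: the two depth-`(l+1)` RAY WORDS of grain 1 (`…StackWalkRay`) are not the chain's first `l + 1`
letters, the two depth-`(c+1)` ray words of grain 2 are not the chain's last `c + 1` letters (read from `A₂`, pulled back
by `A₂⁻¹ ∘ wordFrame A₁ κ`), and `l + c + 1 ≤ k`.  Conclusion: if the tops `e₁`, `e₂` of sound well-formed stacks over
`(A₁,u₁,0)` / `(A₂,u₂,0)` carry CO-AXIAL frames then `InPlaneTwinData e₁ e₂` — they are `T_l` and `T_{l+1}`, mirror twins
about plane `l + 1`, both walk directions in that plane (and necessarily `l + c + 1 = k`; for `l + c + 1 < k` co-axiality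
is refuted outright).  This is the word analysis of `…Sigma9Cross` (`k = 2`), `…Sigma27Cross` (`k = 3`, `l = c = 1`),
`…StackWalkWordSep{,Two,FarTwo}` (`l + c + 1 < k`) done once for all `k, l, c`: reduced-word rigidity
(`map_reflection_eq_of_image_eq`) after cancelling the junction of the transported far word with the chain
(`junction_reduce`), the level laws entering only through `not_suffix_of_ray` / `inner_dir_eq_zero_of_ray`.
Consumed by `…RayCells` (the `c₀ = 1` capstone via `InPlaneTwinOnlyAt`).
WHAT THIS IS NOT: not the stub; no counting; F-C1 not moved.
-/

noncomputable section

namespace Summit.Ventures.Crystal3D.Theorems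

open Summit.Ventures.Crystal3D Finset
open Literature.MathematicalPhysics.StatisticalMechanics (fccStacking barlowStacking IsHaggSeq)
open scoped InnerProductSpace

/-! ### The cross analysis -/

/-- **A co-axial pair of walker tops on a chain pair with ray levels `≤ l`, `≤ c`, `l + c + 1 ≤ k`, is the in-plane twin
pair about plane `l + 1`.**  See the module docstring. -/
theorem inPlaneTwinData_of_coaxial_ray {A₁ A₂ : EuclideanSpace ℝ (Fin 3) ≃ₗᵢ[ℝ] EuclideanSpace ℝ (Fin 3)}
    {u₁ u₂ : EuclideanSpace ℝ (Fin 3)} (κ : List (EuclideanSpace ℝ (Fin 3))) (l c : ℕ)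
    (hκl : ∀ μ ∈ κ, ‖μ‖ = 1 ∧
      ∀ w ∈ fccSlots, ⟪w, μ⟫_ℝ = 0 ∨ ⟪w, μ⟫_ℝ = Real.sqrt (2 / 3) ∨ ⟪w, μ⟫_ℝ = -Real.sqrt (2 / 3))
    (hκc : List.IsChain (fun μ μ' => ⟪μ, μ'⟫_ℝ = 1 / 3 ∨ ⟪μ, μ'⟫_ℝ = -1 / 3) κ)
    (hlc : l + c + 1 ≤ κ.length)
    (hA₂ : A₂ '' fccStacking 1 (Real.sqrt (2 / 3)) = (wordFrame A₁ κ) '' fccStacking 1 (Real.sqrt (2 / 3)))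
    {z₁ z₂ : EuclideanSpace ℝ (Fin 3)}
    (hray₁ : ∀ n : EuclideanSpace ℝ (Fin 3), ‖n‖ = 1 →
      (∀ w ∈ fccSlots, ⟪A₁ w, n⟫_ℝ = 0 ∨ ⟪A₁ w, n⟫_ℝ = Real.sqrt (2 / 3) ∨ ⟪A₁ w, n⟫_ℝ = -Real.sqrt (2 / 3)) →
      ⟪A₁ u₁, n⟫_ℝ = Real.sqrt (2 / 3) →
      (rayWord z₁ ⟨A₁, u₁, 0⟩ n (l + 1)).map (fun μ => (ℝ ∙ μ)ᗮ.reflection) ≠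
        (κ.drop (κ.length - (l + 1))).map (fun μ => (ℝ ∙ μ)ᗮ.reflection))
    (hray₂ : ∀ n : EuclideanSpace ℝ (Fin 3), ‖n‖ = 1 →
      (∀ w ∈ fccSlots, ⟪A₂ w, n⟫_ℝ = 0 ∨ ⟪A₂ w, n⟫_ℝ = Real.sqrt (2 / 3) ∨ ⟪A₂ w, n⟫_ℝ = -Real.sqrt (2 / 3)) →
      ⟪A₂ u₂, n⟫_ℝ = Real.sqrt (2 / 3) →
      (rayWord z₂ ⟨A₂, u₂, 0⟩ n (c + 1)).map (fun μ => (ℝ ∙ μ)ᗮ.reflection) ≠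
        (((κ.take (c + 1)).reverse).map (fun μ => A₂.symm (wordFrame A₁ κ μ))).map (fun μ => (ℝ ∙ μ)ᗮ.reflection))
    {e₁ e₂ : WalkEntry} {rest₁ rest₂ : List WalkEntry}
    (hS₁ : StackSound z₁ (e₁ :: rest₁)) (hW₁ : StackWF z₁ (e₁ :: rest₁)) (hl₁ : (e₁ :: rest₁).getLast? = some ⟨A₁, u₁, 0⟩)
    (hS₂ : StackSound z₂ (e₂ :: rest₂)) (hW₂ : StackWF z₂ (e₂ :: rest₂)) (hl₂ : (e₂ :: rest₂).getLast? = some ⟨A₂, u₂, 0⟩)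
    (hco : ∃ (L : EuclideanSpace ℝ (Fin 3) ≃ₗᵢ[ℝ] EuclideanSpace ℝ (Fin 3))
        (s₁ s₂ : EuclideanSpace ℝ (Fin 3)) (σ σ' : ℤ → ℤ), IsHaggSeq σ ∧ IsHaggSeq σ' ∧
        e₁.frame '' fccStacking 1 (Real.sqrt (2 / 3)) ⊆ (fun p => L p + s₁) '' barlowStacking 1 (Real.sqrt (2 / 3)) σ ∧
        e₂.frame '' fccStacking 1 (Real.sqrt (2 / 3)) ⊆ (fun p => L p + s₂) '' barlowStacking 1 (Real.sqrt (2 / 3)) σ') :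
    InPlaneTwinData e₁ e₂ := by
  -- notation-free abbreviations
  set ρ : EuclideanSpace ℝ (Fin 3) → (EuclideanSpace ℝ (Fin 3) ≃ₗᵢ[ℝ] EuclideanSpace ℝ (Fin 3)) :=
    fun μ => (ℝ ∙ μ)ᗮ.reflection with hρ
  set k := κ.length with hk
  set W := wordFrame A₁ κ with hW
  set ch := κ.drop (k - (l + 1)) with hchdef
  have hchlen : ch.length = l + 1 := by rw [hchdef, List.length_drop]; omega
  have hr : 0 < Real.sqrt (2 / 3) := Real.sqrt_pos.2 (by norm_num)
  -- the near word and its level law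
  obtain ⟨hαl, hαc⟩ := stackWord_letters _ hS₁ hW₁
  set α := stackWord (e₁ :: rest₁) with hα
  have hF₁ : e₁.frame = wordFrame A₁ α := by rw [frame_eq_wordFrame e₁ rest₁ hS₁, stackBase_eq_of_getLast? hl₁]
  have hnear : ¬ ∃ w, α.map ρ = w ++ ch.map ρ :=
    not_suffix_of_ray ch (by rw [← List.length_pos_iff, hchlen]; omega) (by rw [hchlen]; exact hray₁) rest₁ e₁ hS₁ hW₁ hl₁
  -- the lattice symmetry `S = W⁻¹ ∘ A₂` and the transported far word
  obtain ⟨S, hS⟩ : ∃ S : EuclideanSpace ℝ (Fin 3) ≃ₗᵢ[ℝ] EuclideanSpace ℝ (Fin 3), S = A₂.trans W.symm := ⟨_, rfl⟩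
  have hWS : ∀ x, W (S x) = A₂ x := fun x => by rw [hS, LinearIsometryEquiv.trans_apply, LinearIsometryEquiv.apply_symm_apply]
  have hSf : ∀ μ, S (A₂.symm (W μ)) = μ := fun μ => by
    rw [hS, LinearIsometryEquiv.trans_apply, LinearIsometryEquiv.apply_symm_apply, LinearIsometryEquiv.symm_apply_apply]
  have hA₂eq : A₂ = S.trans W := LinearIsometryEquiv.ext fun x => by rw [LinearIsometryEquiv.trans_apply, hWS]
  have hSfcc : S '' fccStacking 1 (Real.sqrt (2 / 3)) = fccStacking 1 (Real.sqrt (2 / 3)) := by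
    rw [hS, LinearIsometryEquiv.coe_trans, Set.image_comp, hA₂, Set.image_image]; simp [hW]
  have hSslots := image_fccSlots_eq_self_of_image_fcc S hSfcc
  have hSmem' : ∀ w ∈ fccSlots, S.symm w ∈ fccSlots := fun w hw => by
    have hw' : w ∈ (S : EuclideanSpace ℝ (Fin 3) → EuclideanSpace ℝ (Fin 3)) '' ↑fccSlots := by
      rw [hSslots]; exact Finset.mem_coe.2 hw
    obtain ⟨w', hw', hw'eq⟩ := hw'; rw [← hw'eq, LinearIsometryEquiv.symm_apply_apply]; exact Finset.mem_coe.1 hw'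
  obtain ⟨hβl, hβc⟩ := stackWord_letters _ hS₂ hW₂
  set β := stackWord (e₂ :: rest₂) with hβ
  have hF₂ : e₂.frame = wordFrame A₂ β := by rw [frame_eq_wordFrame e₂ rest₂ hS₂, stackBase_eq_of_getLast? hl₂]
  set γ := β.map S with hγdef
  have hγl : ∀ μ ∈ γ, ‖μ‖ = 1 ∧
      ∀ w ∈ fccSlots, ⟪w, μ⟫_ℝ = 0 ∨ ⟪w, μ⟫_ℝ = Real.sqrt (2 / 3) ∨ ⟪w, μ⟫_ℝ = -Real.sqrt (2 / 3) := by
    intro μ hμ; obtain ⟨ν, hν, rfl⟩ := List.mem_map.1 hμ; obtain ⟨hνu, hνm⟩ := hβl ν hν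
    refine ⟨by rw [LinearIsometryEquiv.norm_map, hνu], fun w hw => ?_⟩
    have hsw : ⟪w, S ν⟫_ℝ = ⟪S.symm w, ν⟫_ℝ := by
      rw [← LinearIsometryEquiv.inner_map_map S (S.symm w) ν, LinearIsometryEquiv.apply_symm_apply]
    rw [hsw]; exact hνm _ (hSmem' w hw)
  have hγc : List.IsChain (fun μ μ' => ⟪μ, μ'⟫_ℝ = 1 / 3 ∨ ⟪μ, μ'⟫_ℝ = -1 / 3) γ := by
    rw [hγdef, List.isChain_map]; simpa only [LinearIsometryEquiv.inner_map_map] using hβc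
  have hSmem : ∀ w ∈ fccSlots, S w ∈ fccSlots := fun w hw => by
    have : S w ∈ (S : EuclideanSpace ℝ (Fin 3) → EuclideanSpace ℝ (Fin 3)) '' (↑fccSlots : Set _) :=
      ⟨w, Finset.mem_coe.2 hw, rfl⟩
    rw [hSslots] at this; exact Finset.mem_coe.1 this
  have hF₂' : e₂.frame = S.trans (wordFrame A₁ (γ ++ κ)) := by
    rw [hF₂, hA₂eq, wordFrame_trans W S β (fun μ hμ => (hβl μ hμ).1), wordFrame_append]
  -- the far level law, transported
  set fch := ((κ.take (c + 1)).reverse).map (fun μ => A₂.symm (W μ)) with hfchdef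
  have hκne : κ ≠ [] := by rw [← List.length_pos_iff]; omega
  have hfchS : fch.map S = (κ.take (c + 1)).reverse := by
    rw [hfchdef, List.map_map]; conv_rhs => rw [← List.map_id (κ.take (c + 1)).reverse]
    exact List.map_congr_left fun μ _ => hSf μ
  have hfchlen : fch.length = c + 1 := by
    rw [hfchdef, List.length_map, List.length_reverse, List.length_take]; omega
  have hfchl : ∀ x ∈ fch, ‖x‖ = 1 := fun x hx => by
    obtain ⟨μ, hμ, rfl⟩ := List.mem_map.1 hx
    rw [LinearIsometryEquiv.norm_map, LinearIsometryEquiv.norm_map]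
    exact (hκl μ (List.mem_of_mem_take (List.mem_reverse.1 hμ))).1
  have hfar₀ : ¬ ∃ w, β.map ρ = w ++ fch.map ρ :=
    not_suffix_of_ray fch (by rw [← List.length_pos_iff, hfchlen]; omega) (by rw [hfchlen]; exact hray₂) rest₂ e₂ hS₂ hW₂ hl₂
  have hfar : ¬ ∃ w, γ.map ρ = w ++ ((κ.take (c + 1)).reverse).map ρ := by
    rintro ⟨w, hw⟩
    have hlen : c + 1 ≤ β.length := by
      have := congrArg List.length hw
      rw [List.length_map, hγdef, List.length_map, List.length_append, List.length_map, List.length_reverse,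
        List.length_take] at this
      omega
    apply hfar₀
    obtain ⟨β₁, β₂, hsplit, hβ₂len⟩ : ∃ β₁ β₂ : List (EuclideanSpace ℝ (Fin 3)), β = β₁ ++ β₂ ∧ β₂.length = c + 1 :=
      ⟨β.take (β.length - (c + 1)), β.drop (β.length - (c + 1)), (List.take_append_drop _ _).symm,
        by rw [List.length_drop]; omega⟩
    refine ⟨β₁.map ρ, ?_⟩
    have hβ₂l : ∀ x ∈ β₂, ‖x‖ = 1 := fun x hx => (hβl x (by rw [hsplit]; exact List.mem_append_right β₁ hx)).1
    rw [hγdef, hsplit, List.map_append, List.map_append, ← hfchS] at hw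
    have htail := List.append_inj_right' hw (by
      rw [List.length_map, List.length_map, hβ₂len, List.length_map, List.length_map, hfchlen])
    have hβ₂ : β₂.map ρ = fch.map ρ := (map_reflection_map_eq_iff S β₂ fch hβ₂l hfchl).1 htail
    rw [hsplit, List.map_append, hβ₂]
  -- junction cancellation, at most `c` deep
  obtain ⟨j, hjκ, hjγ, hwf, hcan, hnc⟩ := junction_reduce A₁ γ.length γ κ rfl
  set γ' := γ.take (γ.length - j) with hγ'
  set κ' := κ.drop j with hκ'
  have hjc : j ≤ c := by
    by_contra hcj
    rw [not_le] at hcj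
    apply hfar
    have hsplitγ := (List.take_append_drop (γ.length - j) γ).symm
    have hTj : (κ.take j).reverse = ((κ.take j).drop (c + 1)).reverse ++ (κ.take (c + 1)).reverse := by
      conv_lhs => rw [← List.take_append_drop (c + 1) (κ.take j)]
      rw [List.reverse_append, List.take_take, min_eq_left (by omega)]
    refine ⟨γ'.map ρ ++ (((κ.take j).drop (c + 1)).reverse).map ρ, ?_⟩
    rw [hsplitγ, List.map_append, hcan, hTj, List.map_append, List.append_assoc]
  have hκ'len : κ'.length = k - j := by rw [hκ', List.length_drop]
  -- the reduced far word `ω = γ' ++ κ'` and its letters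
  set ω := γ' ++ κ' with hω
  have hγ'sub : ∀ μ ∈ γ', μ ∈ γ := fun μ hμ => List.mem_of_mem_take hμ
  have hκ'sub : ∀ μ ∈ κ', μ ∈ κ := fun μ hμ => List.mem_of_mem_drop hμ
  have hωl : ∀ μ ∈ ω, ‖μ‖ = 1 ∧
      ∀ w ∈ fccSlots, ⟪w, μ⟫_ℝ = 0 ∨ ⟪w, μ⟫_ℝ = Real.sqrt (2 / 3) ∨ ⟪w, μ⟫_ℝ = -Real.sqrt (2 / 3) := by
    intro μ hμ; rcases List.mem_append.1 hμ with h | h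
    · exact hγl μ (hγ'sub μ h)
    · exact hκl μ (hκ'sub μ h)
  have hωc : List.IsChain (fun μ μ' => ⟪μ, μ'⟫_ℝ = 1 / 3 ∨ ⟪μ, μ'⟫_ℝ = -1 / 3) ω := by
    have h1 : List.IsChain (fun μ μ' => ⟪μ, μ'⟫_ℝ = 1 / 3 ∨ ⟪μ, μ'⟫_ℝ = -1 / 3) γ' := by
      have := hγc; rw [← List.take_append_drop (γ.length - j) γ] at this
      exact (List.isChain_append.1 this).1
    have h2 : List.IsChain (fun μ μ' => ⟪μ, μ'⟫_ℝ = 1 / 3 ∨ ⟪μ, μ'⟫_ℝ = -1 / 3) κ' := by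
      have := hκc; rw [← List.take_append_drop j κ] at this
      exact (List.isChain_append.1 this).2.1
    rw [hω, List.isChain_append]
    exact ⟨h1, h2, fun x hx y hy => inner_third_of_reflection_ne (hγl x (hγ'sub x (List.mem_of_getLast? hx)))
      (hκl y (hκ'sub y (List.mem_of_head? hy))) (hnc x hx y hy)⟩
  have hF₂ω : e₂.frame = S.trans (wordFrame A₁ ω) := by rw [hF₂', hwf]
  have himgω : (e₂.frame : EuclideanSpace ℝ (Fin 3) → EuclideanSpace ℝ (Fin 3)) '' ↑fccSlots =
      (wordFrame A₁ ω : EuclideanSpace ℝ (Fin 3) → EuclideanSpace ℝ (Fin 3)) '' ↑fccSlots := by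
    rw [hF₂ω, image_trans_eq, hSslots]
  -- `ch` is a suffix of `κ'`, hence of `ω`
  have hjl : j ≤ k - (l + 1) := by omega
  have hκ'split : κ' = κ'.take (k - (l + 1) - j) ++ ch := by
    rw [hchdef, hκ']
    conv_lhs => rw [← List.take_append_drop (k - (l + 1) - j) (List.drop j κ)]
    rw [List.drop_drop, show j + (k - (l + 1) - j) = k - (l + 1) by omega]
  have hωsuf : ∃ w, ω.map ρ = w ++ ch.map ρ :=
    ⟨(γ' ++ κ'.take (k - (l + 1) - j)).map ρ, by
      rw [hω, ← List.map_append, List.append_assoc, ← hκ'split]⟩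
  -- the rigidity endgame: a reduced word with the slot image of `ω` ends with `ch`
  have hend : ∀ δ : List (EuclideanSpace ℝ (Fin 3)),
      (∀ μ ∈ δ, ‖μ‖ = 1 ∧
        ∀ w ∈ fccSlots, ⟪w, μ⟫_ℝ = 0 ∨ ⟪w, μ⟫_ℝ = Real.sqrt (2 / 3) ∨ ⟪w, μ⟫_ℝ = -Real.sqrt (2 / 3)) →
      List.IsChain (fun μ μ' => ⟪μ, μ'⟫_ℝ = 1 / 3 ∨ ⟪μ, μ'⟫_ℝ = -1 / 3) δ →
      (wordFrame A₁ δ : EuclideanSpace ℝ (Fin 3) → EuclideanSpace ℝ (Fin 3)) '' ↑fccSlots =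
        (wordFrame A₁ ω : EuclideanSpace ℝ (Fin 3) → EuclideanSpace ℝ (Fin 3)) '' ↑fccSlots →
      δ.map ρ = ω.map ρ :=
    fun δ hl hc himg => map_reflection_eq_of_image_eq A₁ hl hc hωl hωc himg
  -- CASE ANALYSIS on the co-axial pair
  rcases eq_or_twin_of_coaxial e₁.frame e₂.frame hco with hEq | ⟨m, hm, hmenu, hEq⟩
  · -- equal lattices: `α ∼ ω` ends with `ch`
    exfalso
    have himg := image_fccSlots_eq_of_image_fcc_eq _ _ hEq
    rw [hF₁, himgω] at himg
    obtain ⟨w, hw⟩ := hωsuf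
    exact hnear ⟨w, by rw [hend α hαl hαc himg, hw]⟩
  -- twins about `m`
  set m' := e₁.frame.symm m with hm'
  have hm'u : ‖m'‖ = 1 := by rw [hm', LinearIsometryEquiv.norm_map, hm]
  have hm'm : ∀ w ∈ fccSlots, ⟪w, m'⟫_ℝ = 0 ∨ ⟪w, m'⟫_ℝ = Real.sqrt (2 / 3) ∨ ⟪w, m'⟫_ℝ = -Real.sqrt (2 / 3) := by
    intro w hw
    rw [hm', ← LinearIsometryEquiv.inner_map_map e₁.frame, LinearIsometryEquiv.apply_symm_apply]; exact hmenu w hw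
  have htw : twinFrame e₁.frame m = wordFrame A₁ (m' :: α) := by
    rw [twinFrame_eq_reflection_trans e₁.frame hm, wordFrame_cons, ← hm', ← hF₁]
  have himg := image_fccSlots_eq_of_image_fcc_eq _ _ hEq
  rw [himgω, htw] at himg
  -- is `m' :: α` reduced?
  by_cases hred : ∀ a ∈ α.head?, ρ m' ≠ ρ a
  swap
  · -- no: it cancels to `α.tail`, which then ends with `ch` — so does `α`
    exfalso
    push Not at hred
    obtain ⟨a, ha, hma⟩ := hred
    obtain ⟨α', hα'⟩ : ∃ α', α = a :: α' := by
      cases hαeq : α with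
      | nil => rw [hαeq] at ha; simp at ha
      | cons a' α' => rw [hαeq] at ha; simp at ha; exact ⟨α', by rw [ha]⟩
    rw [hα', wordFrame_cons_cons_cancel A₁ hma] at himg
    rw [hα'] at hαl hαc
    have hα'map := hend α' (fun μ hμ => hαl μ (List.mem_cons_of_mem a hμ)) hαc.tail himg.symm
    obtain ⟨w, hw⟩ := hωsuf
    exact hnear ⟨ρ a :: w, by rw [hα', List.map_cons, hα'map, hw, List.cons_append]⟩
  -- yes: `m' :: α ∼ ω`
  have hmαl : ∀ μ ∈ m' :: α, ‖μ‖ = 1 ∧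
      ∀ w ∈ fccSlots, ⟪w, μ⟫_ℝ = 0 ∨ ⟪w, μ⟫_ℝ = Real.sqrt (2 / 3) ∨ ⟪w, μ⟫_ℝ = -Real.sqrt (2 / 3) := by
    intro μ hμ; rcases List.mem_cons.1 hμ with rfl | h
    · exact ⟨hm'u, hm'm⟩
    · exact hαl μ h
  have hmαc : List.IsChain (fun μ μ' => ⟪μ, μ'⟫_ℝ = 1 / 3 ∨ ⟪μ, μ'⟫_ℝ = -1 / 3) (m' :: α) :=
    List.isChain_cons.2 ⟨fun a ha => inner_third_of_reflection_ne ⟨hm'u, hm'm⟩ (hαl a (List.mem_of_head? ha))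
      (hred a ha), hαc⟩
  have hmap := hend (m' :: α) hmαl hmαc himg.symm
  obtain ⟨w, hw⟩ := hωsuf
  by_cases hlα : l + 1 ≤ α.length
  · -- `α` is long enough to contain the suffix `ch` itself
    exfalso
    rw [hw, List.map_cons] at hmap
    cases w with
    | nil =>
      have := congrArg List.length hmap
      rw [List.nil_append, List.length_cons, List.length_map, List.length_map, hchlen] at this; omega
    | cons w₀ w' =>
      rw [List.cons_append, List.cons.injEq] at hmap
      exact hnear ⟨w', hmap.2⟩
  -- THE SURVIVING CASE: `α` has length `l`, `γ' = []`, `κ' = ch = μ⋆ :: chₗ`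
  rw [not_le] at hlα
  have hlen := congrArg List.length hmap
  rw [List.length_map, List.length_map, List.length_cons, hω, List.length_append, hκ'len] at hlen
  have hαlen : α.length = l := by omega
  have hγ'nil : γ' = [] := List.eq_nil_of_length_eq_zero (by omega)
  have hjk : k - j = l + 1 := by
    have : γ'.length = 0 := by rw [hγ'nil]; rfl
    omega
  have hjeq : j = c := by omega
  have hωκ' : ω = κ' := by rw [hω, hγ'nil, List.nil_append]
  have hκ'ch : κ' = ch := by rw [hκ', hchdef, show k - (l + 1) = j by omega]
  -- `ch = μ⋆ :: chₗ`
  have hidx : k - (l + 1) < κ.length := by rw [← hk]; omega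
  set μs := κ[k - (l + 1)]'hidx with hμs
  set chl := κ.drop (k - l) with hchl
  have hchcons : ch = μs :: chl := by
    rw [hchdef, List.drop_eq_getElem_cons hidx, hchl, show k - (l + 1) + 1 = k - l by omega]
  have hμsκ : μs ∈ κ := List.getElem_mem hidx
  obtain ⟨hμsu, hμsm⟩ := hκl μs hμsκ
  -- letters: `ρ m' = ρ μ⋆`, `α ∼ chₗ`
  rw [hωκ', hκ'ch, hchcons, List.map_cons, List.map_cons, List.cons.injEq] at hmap
  obtain ⟨hmμ, hαchl⟩ := hmap
  -- consecutive chain letters have different mirrors (for the direction lemmas)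
  have hch_chain : List.IsChain (fun μ μ' => ⟪μ, μ'⟫_ℝ = 1 / 3 ∨ ⟪μ, μ'⟫_ℝ = -1 / 3) (μs :: chl) := by
    rw [← hchcons, hchdef]; have := hκc; rw [← List.take_append_drop (k - (l + 1)) κ] at this
    exact (List.isChain_append.1 this).2.1
  have hμsch : ∀ x ∈ chl.head?, ρ μs ≠ ρ x := fun x hx =>
    reflection_ne_of_inner_third hμsu (hκl x (List.mem_of_mem_drop (List.mem_of_head? hx))).1
      ((List.isChain_cons.1 hch_chain).1 x hx)
  -- (4) grain 1's direction lies in plane `l + 1`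
  have hd₁ : ⟪e₁.dir, μs⟫_ℝ = 0 := by
    refine inner_dir_eq_zero_of_ray μs chl hμsu hμsm hμsch (fun n hn hmn hpn => ?_) rest₁ e₁ hS₁ hW₁ hl₁ hαchl
    have hl' : chl.length + 1 = l + 1 := by
      have := hchlen; rw [hchcons, List.length_cons] at this; omega
    rw [hl', ← hchcons]; exact hray₁ n hn hmn hpn
  -- (5) grain 2's direction: its word is the far chain of length `c`, the next far letter is `A₂⁻¹ W μ⋆`
  have hγeq : γ.map ρ = ((κ.take c).reverse).map ρ := by
    have : γ.length - j = 0 := by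
      have h0 : γ'.length = 0 := by rw [hγ'nil]; rfl
      rw [hγ', List.length_take] at h0; omega
    rw [this, List.drop_zero, hjeq] at hcan; exact hcan
  set fchc := ((κ.take c).reverse).map (fun μ => A₂.symm (W μ)) with hfchc
  have hfchcS : fchc.map S = (κ.take c).reverse := by
    rw [hfchc, List.map_map]; conv_rhs => rw [← List.map_id (κ.take c).reverse]
    exact List.map_congr_left fun μ _ => hSf μ
  have hfchcl : ∀ x ∈ fchc, ‖x‖ = 1 := fun x hx => by
    obtain ⟨μ, hμ, rfl⟩ := List.mem_map.1 hx
    rw [LinearIsometryEquiv.norm_map, LinearIsometryEquiv.norm_map]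
    exact (hκl μ (List.mem_of_mem_take (List.mem_reverse.1 hμ))).1
  have hβword : β.map ρ = fchc.map ρ := by
    refine (map_reflection_map_eq_iff S β fchc (fun x hx => (hβl x hx).1) hfchcl).1 ?_
    rw [hfchcS, ← hγdef]; exact hγeq
  have hck : c < κ.length := by rw [← hk]; omega
  have hκc_eq : κ[c]'hck = μs := by
    simp only [hμs]; congr 1; omega
  have hfch_cons : fch = A₂.symm (W μs) :: fchc := by
    rw [hfchdef, hfchc, List.take_succ_eq_append_getElem hck, List.reverse_append, List.reverse_singleton,
      List.singleton_append, List.map_cons, hκc_eq]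
  have hfu : ‖A₂.symm (W μs)‖ = 1 := by rw [LinearIsometryEquiv.norm_map, LinearIsometryEquiv.norm_map, hμsu]
  have hfm : ∀ w ∈ fccSlots, ⟪w, A₂.symm (W μs)⟫_ℝ = 0 ∨ ⟪w, A₂.symm (W μs)⟫_ℝ = Real.sqrt (2 / 3) ∨
      ⟪w, A₂.symm (W μs)⟫_ℝ = -Real.sqrt (2 / 3) := by
    intro w hw
    have : ⟪w, A₂.symm (W μs)⟫_ℝ = ⟪S w, μs⟫_ℝ := by
      rw [← LinearIsometryEquiv.inner_map_map S w, hSf]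
    rw [this]; exact hμsm _ (hSmem w hw)
  have hfch_head : ∀ x ∈ fchc.head?, ρ (A₂.symm (W μs)) ≠ ρ x := by
    intro x hx hR
    cases c with
    | zero => simp [hfchc] at hx
    | succ c' =>
      have hc'k : c' < κ.length := by omega
      have hx' : x = A₂.symm (W (κ[c']'hc'k)) := by
        rw [hfchc, List.take_succ_eq_append_getElem hc'k, List.reverse_append, List.reverse_singleton,
          List.singleton_append, List.map_cons, List.head?_cons, Option.mem_def, Option.some.injEq] at hx
        exact hx.symm
      obtain ⟨hκc'u, -⟩ := hκl _ (List.getElem_mem hc'k)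
      have hR' : ρ μs = ρ (κ[c']'hc'k) := by
        rw [hx'] at hR
        exact (reflection_map_eq_iff (W.trans A₂.symm) hμsu hκc'u).1 hR
      -- `κ[c']` and `κ[c'+1] = μ⋆` are consecutive in the chain `κ`
      have hchain := (List.isChain_iff_getElem.1 hκc) c' (by omega)
      rw [hκc_eq] at hchain
      exact reflection_ne_of_inner_third hκc'u hμsu hchain hR'.symm
  have hd₂ : ⟪e₂.dir, A₂.symm (W μs)⟫_ℝ = 0 := by
    refine inner_dir_eq_zero_of_ray (A₂.symm (W μs)) fchc hfu hfm hfch_head (fun n hn hmn hpn => ?_)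
      rest₂ e₂ hS₂ hW₂ hl₂ hβword
    have hl' : fchc.length + 1 = c + 1 := by
      rw [hfchc, List.length_map, List.length_reverse, List.length_take]; omega
    rw [hl', ← hfch_cons]; exact hray₂ n hn hmn hpn
  -- assembling the twin data about `ν = m = ± e₁.frame μ⋆`
  have hm_eq : m = e₁.frame μs ∨ m = -e₁.frame μs := by
    rcases eq_or_eq_neg_of_reflection_eq hm'u hμsu hmμ with h | h
    · left; rw [← h, hm', LinearIsometryEquiv.apply_symm_apply]
    · right; rw [← map_neg, ← h, hm', LinearIsometryEquiv.apply_symm_apply]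
  have hF₁chl : e₁.frame = wordFrame A₁ chl := by rw [hF₁]; exact wordFrame_eq_of_map_eq A₁ hαchl
  have he₂f : e₂.frame (A₂.symm (W μs)) = -e₁.frame μs := by
    rw [hF₂ω, LinearIsometryEquiv.trans_apply, hSf, hωκ', hκ'ch, hchcons, wordFrame_cons,
      LinearIsometryEquiv.trans_apply, Submodule.reflection_orthogonalComplement_singleton_eq_neg, map_neg, ← hF₁chl]
  refine ⟨m, hm, hmenu, hEq, ?_, ?_⟩
  · rcases hm_eq with h | h
    · rw [h, LinearIsometryEquiv.inner_map_map]; exact hd₁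
    · rw [h, inner_neg_right, LinearIsometryEquiv.inner_map_map, hd₁, neg_zero]
  · have h0 : ⟪e₂.frame e₂.dir, e₁.frame μs⟫_ℝ = 0 := by
      have := hd₂
      rw [← LinearIsometryEquiv.inner_map_map e₂.frame, he₂f, inner_neg_right, neg_eq_zero] at this
      exact this
    rcases hm_eq with h | h
    · rw [h]; exact h0
    · rw [h, inner_neg_right, h0, neg_zero]

end Summit.Ventures.Crystal3D.Theorems

end
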